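import Literature.Probability.LatticeModels.SubmultiplicativeTreeWeight
import Literature.MathematicalPhysics.QuantumLattice.LatticeToriProofs
import HarnessLib

/-!
# Label pseudo-distances on periodic index sets (torus sites, imaginary-time slices, internal indices)

Topic `MathematicalPhysics/QuantumLattice`; the concrete instances of `IsLabelDist` (`SubmultiplicativeTreeWeight.lean`)
needed to run the decay-weighted single-scale engine (`GrassmannWeightedEffectiveActionBound.lean`) on the space-time
labels of a lattice fermion model on a torus at positive temperature (Benfatto–Giuliani–Mastropietro 2006, §2.1: the
space-time box `Λ × [0, β)` with (anti)periodic boundary conditions; §3 (3.2): moments `∫ dx |x|ⁿ |β²_h(x)|` in the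
periodic distance).  A label pseudo-distance may vanish between distinct labels — internal indices (spin, charge,
sector) are invisible — so every instance is obtained from two periodic ones by pull-back and nonnegative combination:

* `IsLabelDist.zero`, `IsLabelDist.add`, `IsLabelDist.smul`, `IsLabelDist.comap` — the combinators;
* `cyclicDist n a b = min ((a-b).val, n - (a-b).val)` on `ZMod n` (the graph distance on the cycle), a label
  pseudo-distance (`isLabelDist_cyclicDist`), at most `n/2` (`cyclicDist_le_half`);
* `torusSiteDist x y = torusDist x y` (the periodic `ℓ^∞` distance of `LatticeTori.lean`) on `TorusSite d L`, a label
  pseudo-distance (`isLabelDist_torusSiteDist`);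
* `finCyclicDist n i j` — the cyclic distance of the imaginary-time slices `Fin n` (read in `ZMod n`), and the scaled
  space-time pseudo-distance `spaceTimeDist cₜ cₓ (t, x) (t', x') = cₜ · finCyclicDist t t' + cₓ · torusSiteDist x x'`
  on `Fin n × TorusSite d L` (`isLabelDist_spaceTimeDist`; `cₜ = β/n` and `cₓ = 1`, or the scale factors `γ^h`, are the
  intended choices), and its pull-back to labels with internal indices (`isLabelDist_spaceTimeDist_comap`).

Everything is proved; the definitions are the four distances. [folklore]

## Sources

G. Benfatto, A. Giuliani, V. Mastropietro, Ann. Henri Poincaré 7 (2006) 809–898, §2.1 and §3 (3.2)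
(`BenfattoGiulianiMastropietro2006`); S. Friedli, Y. Velenik, *Statistical Mechanics of Lattice Systems* (2017), §3.1
(periodic boundary conditions) (`FriedliVelenik2017`).
-/

noncomputable section

open Finset

/-! ### Combinators -/

namespace Literature.Probability.LatticeModels.BattleFederbush.IsLabelDist

variable {Λ Λ' : Type*} {d d₁ d₂ : Λ → Λ → ℝ}

/-- The zero pseudo-distance. [folklore] -/
theorem zero : IsLabelDist (fun _ _ : Λ => (0 : ℝ)) where
  self _ := rfl
  symm _ _ := rfl
  nonneg _ _ := le_rfl
  triangle _ _ _ := by rw [add_zero]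

/-- Sums of label pseudo-distances. [folklore] -/
theorem add (h₁ : IsLabelDist d₁) (h₂ : IsLabelDist d₂) : IsLabelDist (fun a b => d₁ a b + d₂ a b) where
  self a := by rw [h₁.self, h₂.self, add_zero]
  symm a b := by rw [h₁.symm, h₂.symm]
  nonneg a b := add_nonneg (h₁.nonneg a b) (h₂.nonneg a b)
  triangle a b c := by linarith [h₁.triangle a b c, h₂.triangle a b c]

/-- Nonnegative multiples of a label pseudo-distance. [folklore] -/
theorem smul (h : IsLabelDist d) {c : ℝ} (hc : 0 ≤ c) : IsLabelDist (fun a b => c * d a b) where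
  self a := by rw [h.self, mul_zero]
  symm a b := by rw [h.symm]
  nonneg a b := mul_nonneg hc (h.nonneg a b)
  triangle a b e := by rw [← mul_add]; exact mul_le_mul_of_nonneg_left (h.triangle a b e) hc

/-- **Pull-back along any map** (internal indices are forgotten): `(a, b) ↦ d (f a) (f b)`. [folklore] -/
theorem comap (h : IsLabelDist d) (f : Λ' → Λ) : IsLabelDist (fun a b => d (f a) (f b)) where
  self _ := h.self _
  symm _ _ := h.symm _ _
  nonneg _ _ := h.nonneg _ _
  triangle _ _ _ := h.triangle _ _ _

end Literature.Probability.LatticeModels.BattleFederbush.IsLabelDist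

/-! ### Periodic instances -/

namespace Literature.MathematicalPhysics.QuantumLattice

open Literature.Probability.LatticeModels Literature.Probability.LatticeModels.BattleFederbush

/-- The **cyclic distance** on `ZMod n`: `min ((a - b).val, n - (a - b).val)` (the graph distance on the `n`-cycle).
[folklore] -/
def cyclicDist (n : ℕ) (a b : ZMod n) : ℝ := (min (a - b).val (n - (a - b).val) : ℕ)

/-- **The cyclic distance is a label pseudo-distance** (`n ≠ 0`). [folklore] -/
theorem isLabelDist_cyclicDist (n : ℕ) [NeZero n] : IsLabelDist (cyclicDist n) where
  self a := by simp [cyclicDist]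
  symm a b := by
    rw [cyclicDist, cyclicDist, ← neg_sub b a, cyclicAbs_neg]
  nonneg a b := Nat.cast_nonneg _
  triangle a b c := by
    rw [cyclicDist, cyclicDist, cyclicDist, ← Nat.cast_add, Nat.cast_le, show a - c = (a - b) + (b - c) by abel]
    exact cyclicAbs_add_le n _ _

/-- The cyclic distance is at most `n / 2`. [folklore] -/
theorem cyclicDist_le_half (n : ℕ) [NeZero n] (a b : ZMod n) : cyclicDist n a b ≤ n / 2 := by
  rw [cyclicDist, le_div_iff₀ (two_pos : (0 : ℝ) < 2)]
  have hv := ZMod.val_lt (a - b)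
  have h : min (a - b).val (n - (a - b).val) * 2 ≤ n := by omega
  exact_mod_cast h

/-- The cyclic distance of imaginary-time slices `Fin n`, read in `ZMod n`. [folklore] -/
def finCyclicDist (n : ℕ) (i j : Fin n) : ℝ := cyclicDist n ((i : ℕ) : ZMod n) ((j : ℕ) : ZMod n)

/-- The cyclic distance of the slices is a label pseudo-distance. [folklore] -/
theorem isLabelDist_finCyclicDist (n : ℕ) [NeZero n] : IsLabelDist (finCyclicDist n) :=
  (isLabelDist_cyclicDist n).comap fun i : Fin n => ((i : ℕ) : ZMod n)

variable {d L : ℕ}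

/-- The **periodic `ℓ^∞` distance of torus sites** as a real number (`torusDist` of `LatticeTori.lean`). [folklore] -/
def torusSiteDist (x y : TorusSite d L) : ℝ := (torusDist (Ls := fun _ : Fin d => L) x y : ℕ)

/-- **The torus distance is a label pseudo-distance** (`L ≠ 0`). [folklore] -/
theorem isLabelDist_torusSiteDist [NeZero L] : IsLabelDist (torusSiteDist (d := d) (L := L)) where
  self x := by simp [torusSiteDist]
  symm x y := by rw [torusSiteDist, torusSiteDist, torusDist_comm']
  nonneg x y := Nat.cast_nonneg _
  triangle x y z := by
    rw [torusSiteDist, torusSiteDist, torusSiteDist, ← Nat.cast_add, Nat.cast_le]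
    exact torusDist_triangle' (Ls := fun _ : Fin d => L) x y z

/-- The **scaled space-time pseudo-distance** on `Fin n × TorusSite d L`:
`cₜ · (cyclic distance of the time slices) + cₓ · (torus distance of the sites)`. [folklore] -/
def spaceTimeDist (n : ℕ) (ct cx : ℝ) (a b : Fin n × TorusSite d L) : ℝ :=
  ct * finCyclicDist n a.1 b.1 + cx * torusSiteDist a.2 b.2

/-- **The scaled space-time pseudo-distance is a label pseudo-distance** (`cₜ, cₓ ≥ 0`, `n, L ≠ 0`). [folklore] -/
theorem isLabelDist_spaceTimeDist (n : ℕ) [NeZero n] [NeZero L] {ct cx : ℝ} (hct : 0 ≤ ct) (hcx : 0 ≤ cx) :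
    IsLabelDist (spaceTimeDist (d := d) (L := L) n ct cx) :=
  (((isLabelDist_finCyclicDist n).comap (Prod.fst : Fin n × TorusSite d L → Fin n)).smul hct).add
    ((isLabelDist_torusSiteDist.comap (Prod.snd : Fin n × TorusSite d L → TorusSite d L)).smul hcx)

/-- **Labels with internal indices**: pulling the space-time pseudo-distance back along the position map of any label
type (spin, charge, sector leg, derived-field direction … are invisible) gives a label pseudo-distance. [folklore] -/
theorem isLabelDist_spaceTimeDist_comap {Γ : Type*} (n : ℕ) [NeZero n] [NeZero L] (pos : Γ → Fin n × TorusSite d L)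
    {ct cx : ℝ} (hct : 0 ≤ ct) (hcx : 0 ≤ cx) :
    IsLabelDist (fun a b : Γ => spaceTimeDist n ct cx (pos a) (pos b)) :=
  (isLabelDist_spaceTimeDist n hct hcx).comap pos

/-- The space-time pseudo-distance is bounded on the finite box: `≤ cₜ n/2 + cₓ L`. [folklore] -/
theorem spaceTimeDist_le (n : ℕ) [NeZero n] [NeZero L] {ct cx : ℝ} (hct : 0 ≤ ct) (hcx : 0 ≤ cx) (a b : Fin n × TorusSite d L) :
    spaceTimeDist n ct cx a b ≤ ct * (n / 2) + cx * L := by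
  unfold spaceTimeDist finCyclicDist
  refine add_le_add (mul_le_mul_of_nonneg_left (cyclicDist_le_half n _ _) hct) (mul_le_mul_of_nonneg_left ?_ hcx)
  rw [torusSiteDist]
  exact_mod_cast (torusDist_lt (d := d) (L := L) a.2 b.2).le

end Literature.MathematicalPhysics.QuantumLattice
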